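import Summits.BirchSwinnertonDyer.BirchSwinnertonDyer.Theorems.EdgeCap.Negative.FibreStrassmann

/-!
# Crux `TangentCone.EdgeCap` (stmt-BirchSwinnertonDyer-17609), line `ratio_measure_strassmann` —
# layer S: a non-zero weight fibre is non-zero at a cyclotomic reference point of the tame component `ω⁰`

Helper file (`--supports stmt-BirchSwinnertonDyer-17609`) of the lead prover of line `ratio_measure_strassmann`.
Layer S of the skeleton (`Cruxes/EdgeCap/Lines/ratio_measure_strassmann.lean`, proved in-file by the crux strategist,
v4) re-derived in a definition-free form from the fibrewise Strassmann theorem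
`EdgeCap.Negative.fibre_eq_zero_of_zeros` landed by the crux's disprover
(`Theorems/EdgeCap/Negative/FibreStrassmann.lean`): for an integral `F ∈ ℚ_p⟦X, Y⟧` and `‖x‖ < 1`, if the fibre
`y ↦ F(x, y)` is not identically zero on the open unit disc of `ℚ_p`, then it is non-zero at one of the reference
points `y_{j_m} = (1+p)^{j_m − 1} − 1`, `j_m = 2(p−1)(m+1) + 1` (odd, `≥ 3`, `≡ 1 (mod p−1)`), because these are
infinitely many distinct points of the disc while a non-zero element of `Λ = ℤ_p⟦Y⟧` has finitely many zeros there
(`p`-adic Weierstrass preparation, Lang, *Cyclotomic Fields I–II*, Ch. 5 §2 Thm. 2.2).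

No definitions (the reference index is kept as the explicit expression `2 * ((p - 1) * (m + 1)) + 1`).
-/

-- The directory layout `Summits/BirchSwinnertonDyer/BirchSwinnertonDyer/…` forces the duplicated segment.
set_option linter.dupNamespace false

noncomputable section

namespace Summit.BirchSwinnertonDyer.BirchSwinnertonDyer.Theorems.TangentConeEdgeCap

open Literature.NumberTheory.EllipticCurves
open Summit.BirchSwinnertonDyer.BirchSwinnertonDyer.Theorems.EdgeCap.Negative

/-! ## The reference indices `j_m = 2(p−1)(m+1) + 1` -/

/-- The reference indices are odd. -/
theorem refIdx_odd (p m : ℕ) : Odd (2 * ((p - 1) * (m + 1)) + 1) := ⟨(p - 1) * (m + 1), rfl⟩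

/-- `3 ≤ j_m` (for `p ≥ 2`). -/
theorem three_le_refIdx {p : ℕ} (hp : 2 ≤ p) (m : ℕ) : 3 ≤ 2 * ((p - 1) * (m + 1)) + 1 := by
  have : 1 ≤ (p - 1) * (m + 1) := Nat.one_le_iff_ne_zero.mpr (Nat.mul_ne_zero (by omega) (by omega))
  omega

/-- `j_m ≡ 1 (mod p−1)`: the reference points lie on the tame component `ω⁰`. -/
theorem dvd_refIdx_sub_one (p m : ℕ) : (p - 1) ∣ (2 * ((p - 1) * (m + 1)) + 1 - 1) :=
  ⟨2 * (m + 1), by rw [Nat.add_sub_cancel]; ring⟩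

/-- `m ↦ j_m` is injective (for `p ≥ 2`). -/
theorem refIdx_injective {p : ℕ} (hp : 2 ≤ p) :
    Function.Injective fun m : ℕ => 2 * ((p - 1) * (m + 1)) + 1 := by
  intro m m' h
  have h1 : (p - 1) * (m + 1) = (p - 1) * (m' + 1) := by simp only at h; omega
  have h2 := Nat.eq_of_mul_eq_mul_left (by omega : 0 < p - 1) h1
  omega

/-- The reference points `y_{j_m} = (1+p)^{j_m − 1} − 1` are pairwise distinct. -/
theorem refPoint_injective (p : ℕ) [Fact p.Prime] :
    Function.Injective fun m : ℕ => (1 + (p : ℚ_[p])) ^ (2 * ((p - 1) * (m + 1)) + 1 - 1) - 1 := by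
  intro m m' h
  have hp2 : 2 ≤ p := (Fact.out : p.Prime).two_le
  have h1 : 2 * ((p - 1) * (m + 1)) + 1 - 1 = 2 * ((p - 1) * (m' + 1)) + 1 - 1 :=
    one_add_pow_sub_one_injective p h
  simp only [Nat.add_sub_cancel] at h1
  have h3 : (p - 1) * (m + 1) = (p - 1) * (m' + 1) := by omega
  have h4 := Nat.eq_of_mul_eq_mul_left (by omega : 0 < p - 1) h3
  omega

/-! ## Layer S -/

/-- **S, pointwise · a non-zero weight fibre is non-zero at a reference point.** For an integral two-variable series
`F` and `‖x‖ < 1`: if `F(x, y) ≠ 0` for some `‖y‖ < 1`, then `F(x, y_j) ≠ 0` for some odd `j ≥ 3` with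
`(p − 1) ∣ (j − 1)`, `y_j = (1+p)^{j−1} − 1` (indeed `j = j_m` for some `m`). Contrapositive of the disprover's
fibrewise Strassmann theorem `EdgeCap.Negative.fibre_eq_zero_of_zeros` along the injective sequence of reference
points. -/
theorem exists_refIdx_ne_zero (p : ℕ) [Fact p.Prime] (F : MvPowerSeries (Fin 2) ℚ_[p]) (hF : IsPadicInt F)
    {x : ℚ_[p]} (hx : ‖x‖ < 1) (h : ∃ y : ℚ_[p], ‖y‖ < 1 ∧ padicEval₂ F x y ≠ 0) :
    ∃ j : ℕ, Odd j ∧ 3 ≤ j ∧ (p - 1) ∣ (j - 1) ∧ padicEval₂ F x ((1 + (p : ℚ_[p])) ^ (j - 1) - 1) ≠ 0 := by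
  have hp2 : 2 ≤ p := (Fact.out : p.Prime).two_le
  by_contra hall
  push Not at hall
  have hz0 : ∀ m : ℕ, padicEval₂ F x ((1 + (p : ℚ_[p])) ^ (2 * ((p - 1) * (m + 1)) + 1 - 1) - 1) = 0 :=
    fun m => hall _ (refIdx_odd p m) (three_le_refIdx hp2 m) (dvd_refIdx_sub_one p m)
  have hvan := fibre_eq_zero_of_zeros F hF hx (refPoint_injective p)
    (fun m => norm_one_add_pow_sub_one_lt p _) hz0
  obtain ⟨y, hy, hne⟩ := h
  exact hne (hvan y hy)

/-- **S · `fibreStrassmann`** — if no weight fibre of the integral two-variable series `F` vanishes identically on the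
open unit disc of `ℚ_p`, then every fibre is non-zero at one of the cyclotomic reference points `y_j = (1+p)^{j−1} − 1`,
`j` odd, `≥ 3`, `j ≡ 1 (mod p−1)` — the hypothesis of layer U (`uniformReference`). -/
theorem fibreStrassmann :
    ∀ (p : ℕ) [Fact p.Prime] (F : MvPowerSeries (Fin 2) ℚ_[p]), Literature.NumberTheory.EllipticCurves.IsPadicInt F → (∀ x : ℚ_[p], ‖x‖ < 1 → ∃ y : ℚ_[p], ‖y‖ < 1 ∧ Literature.NumberTheory.EllipticCurves.padicEval₂ F x y ≠ 0) → ∀ x : ℚ_[p], ‖x‖ < 1 → ∃ j : ℕ, Odd j ∧ 3 ≤ j ∧ (p - 1) ∣ (j - 1) ∧ Literature.NumberTheory.EllipticCurves.padicEval₂ F x ((1 + (p : ℚ_[p])) ^ (j - 1) - 1) ≠ 0 :=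
  fun p _ F hF h x hx => exists_refIdx_ne_zero p F hF hx (h x hx)

end Summit.BirchSwinnertonDyer.BirchSwinnertonDyer.Theorems.TangentConeEdgeCap

end
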